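import Literature.Probability.RandomPlanarGeometry.SAWCountMonotoneReversal
import Literature.Probability.RandomPlanarGeometry.SAWFiniteMemoryTwo
import Literature.Probability.RandomPlanarGeometry.SAWRatioLimit
import HarnessLib

/-!
# Monotonicity `cₙ ≤ cₙ₊₁` (O'Brien 1990) for short walks in every dimension: no self-avoiding walk
# with fewer than `4d - 1` steps is trapped

Sequel of `BDGS2012CountMonoExt.lean` (the trapped-walk criterion `count_le_count_succ_of_trapped_injOn`:
`cₙ ≤ cₙ₊₁` as soon as the TRAPPED `n`-step walks — `extCount ω n = 0`, no free extension — inject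
into the walks with two free extensions) and of `SAWCountMonotoneReversal.lean` (`doublyTrapped`).

**Parity.** `ℤ^d` is bipartite: along a nearest-neighbour walk the coordinate sum has the parity of
the time (`exists_sum_apply_eq_add_two_mul`), so a site adjacent to `ω n` can only have been visited
at a time `i` with `i + n` odd (`odd_add_of_adj_apply`).  If the endpoint is trapped, its `2d`
neighbours are `2d` distinct such sites, visited at `2d` distinct times in `{n-1, n-3, …}`, whence
`2d ≤ ⌊(n+1)/2⌋`:

* `four_mul_le_of_extCount_eq_zero` : a trapped `n`-step self-avoiding walk has `4d ≤ n + 1`;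
* `count_le_count_succ_of_le` : **`cₙ ≤ cₙ₊₁` for all `n ≤ 4d - 2`, in every dimension `d`**
  (there is no trapped walk to repair); `doublyTrapped_eq_empty_of_le` likewise;
* `count_one_le_count_one_succ` : the case `d = 1` of the named fact `BDGS2012_count_mono` in full
  (`c₀ = 1`, `cₙ = 2` for `n ≥ 1`, from `count_one_eq_two` of `SAWRatioLimit.lean`).

The threshold `4d - 1` is sharp in `d = 2` (the `7`-step walk `0, e₂, e₁+e₂, 2e₁+e₂, 2e₁, 2e₁-e₂, e₁-e₂, e₁`
is trapped) and in `d = 3` (`11` steps: `0, e₂, e₁+e₂, e₁+e₂+e₃, e₁+e₃, 2e₁+e₃, 2e₁, 2e₁-e₂, e₁-e₂,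
e₁-e₂-e₃, e₁-e₃, e₁` tours the six neighbours of `e₁` at the even times and finishes at `e₁`).

[cite: MadrasSlade1993, §1.2 (p. 10: sites at times of different parity are distinct); §7.1]
[cite: BDGS2012, §1.3 (`cₙ ≤ cₙ₊₁`, O'Brien 1990)]
-/

noncomputable section

open Literature.Probability.LatticeModels Literature.Probability.Percolation SimpleGraph
open scoped BigOperators

namespace Literature.Probability.RandomPlanarGeometry.SAW.Zd

variable {d : ℕ}

/-! ### Parity along a walk -/

/-- A lattice step changes the coordinate sum by `± 1` (a nearest-neighbour step changes one coordinate by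
`± 1`). [cite: MadrasSlade1993, §1.1] -/
theorem sum_apply_eq_of_adj {x y : Site d} (h : (zdGraph d).Adj x y) :
    (∑ k, y k) = (∑ k, x k) + 1 ∨ (∑ k, y k) = (∑ k, x k) - 1 := by
  obtain ⟨i, hi | hi⟩ := (zdGraph_adj_iff x y).1 h
  · left
    rw [hi]; simp only [Pi.add_apply, Finset.sum_add_distrib, Finset.sum_pi_single', Finset.mem_univ,
      if_true]
  · right
    rw [hi]; simp only [Pi.add_apply, Finset.sum_add_distrib, Finset.sum_pi_single', Finset.mem_univ,
      if_true]; ring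

/-- **Along a self-avoiding walk the coordinate sum has the parity of the time** (`ℤ^d` is bipartite).
[cite: MadrasSlade1993, §1.2, p. 10] -/
theorem exists_sum_apply_eq_add_two_mul {n : ℕ} {ω : ℕ → Site d} (hω : ω ∈ saws d n) :
    ∀ j ≤ n, ∃ m : ℤ, (∑ k, ω j k) = j + 2 * m := by
  obtain ⟨h0, -, hadj, -⟩ := mem_saws.1 hω
  intro j hj
  induction j with
  | zero => exact ⟨0, by rw [h0]; simp⟩
  | succ j ih =>
    obtain ⟨m, hm⟩ := ih (by omega)
    rcases sum_apply_eq_of_adj (hadj j (by omega)) with h | h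
    · exact ⟨m, by rw [h, hm]; push_cast; ring⟩
    · exact ⟨m - 1, by rw [h, hm]; push_cast; ring⟩

/-- **A site adjacent to `ω n` was visited, if at all, at a time of the other parity**: if `ω i` is a
neighbour of `ω n` (`i ≤ n`) then `i + n` is odd. [cite: MadrasSlade1993, §1.2, p. 10] -/
theorem odd_add_of_adj_apply {n i : ℕ} {ω : ℕ → Site d} (hω : ω ∈ saws d n) (hi : i ≤ n)
    (hadj : (zdGraph d).Adj (ω n) (ω i)) : (i + n) % 2 = 1 := by
  obtain ⟨m, hm⟩ := exists_sum_apply_eq_add_two_mul hω i hi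
  obtain ⟨m', hm'⟩ := exists_sum_apply_eq_add_two_mul hω n le_rfl
  rcases sum_apply_eq_of_adj hadj with h | h <;> rw [hm, hm'] at h <;> omega

/-! ### No short trapped walks -/

/-- **A trapped self-avoiding walk has at least `4d - 1` steps.** If the endpoint of an `n`-step
self-avoiding walk on `ℤ^d` has no free extension, its `2d` neighbours were visited at `2d` distinct
times `i ≤ n - 1` with `i + n` odd, so `2d ≤ ⌊(n+1)/2⌋`, i.e. `4d ≤ n + 1`.
[cite: MadrasSlade1993, §1.2, p. 10; §7.1] -/
theorem four_mul_le_of_extCount_eq_zero {n : ℕ} {ω : ℕ → Site d} (hω : ω ∈ saws d n)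
    (h0 : extCount ω n = 0) : 4 * d ≤ n + 1 := by
  classical
  -- every neighbour of the endpoint is visited: choose a visiting time
  have hvis : ∀ y ∈ nbrs (ω n), ∃ i ≤ n, ω i = y := by
    intro y hy
    by_contra h
    have : y ∈ freeNbrs ω n := mem_freeNbrs.2 ⟨mem_nbrs.1 hy, fun i hi hiy => h ⟨i, hi, hiy⟩⟩
    rw [extCount, Finset.card_eq_zero] at h0
    rw [h0] at this
    exact Finset.notMem_empty y this
  choose! τ hτle hτeq using hvis
  -- the visiting time has the other parity, and `τ / 2` is injective on the neighbours
  have hodd : ∀ y ∈ nbrs (ω n), (τ y + n) % 2 = 1 := fun y hy =>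
    odd_add_of_adj_apply hω (hτle y hy) (by rw [hτeq y hy]; exact mem_nbrs.1 hy)
  have hmaps : ∀ y ∈ nbrs (ω n), τ y / 2 ∈ Finset.range ((n + 1) / 2) := by
    intro y hy
    have h1 := hτle y hy
    have h2 := hodd y hy
    rw [Finset.mem_range]
    omega
  have hinj : Set.InjOn (fun y => τ y / 2) (nbrs (ω n) : Set (Site d)) := by
    intro y hy y' hy' h
    rw [Finset.mem_coe] at hy hy'
    have h2 := hodd y hy
    have h2' := hodd y' hy'
    have : τ y = τ y' := by simp only at h; omega
    rw [← hτeq y hy, ← hτeq y' hy', this]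
  have hcard := Finset.card_le_card_of_injOn (fun y => τ y / 2) hmaps hinj
  rw [card_nbrs, Finset.card_range] at hcard
  omega

/-- Equivalently: for `n ≤ 4d - 2` every `n`-step self-avoiding walk has a free extension.
[cite: MadrasSlade1993, §7.1] -/
theorem extCount_pos_of_le {n : ℕ} {ω : ℕ → Site d} (hω : ω ∈ saws d n) (hn : n + 2 ≤ 4 * d) :
    0 < extCount ω n := by
  by_contra h
  have := four_mul_le_of_extCount_eq_zero hω (by omega)
  omega

/-- **`cₙ ≤ cₙ₊₁` for short walks in every dimension**: if `n ≤ 4d - 2` there is no trapped `n`-step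
self-avoiding walk on `ℤ^d`, so the trapped-walk criterion holds vacuously.  (For `d = 2` this covers
`n ≤ 6`, for `d = 3` `n ≤ 10`; the general inequality is O'Brien's theorem, the tree's named fact
`BDGS2012_count_mono`.) [cite: BDGS2012, §1.3] [cite: MadrasSlade1993, §7.1] -/
theorem count_le_count_succ_of_le {n : ℕ} (hn : n + 2 ≤ 4 * d) : count d n ≤ count d (n + 1) :=
  count_le_count_succ_of_trapped_injOn (fun ω => ω)
    (fun _ hω h0 => absurd h0 (extCount_pos_of_le hω hn).ne') (fun _ _ _ _ h => h)

/-- For `n ≤ 4d - 2` the set of doubly trapped `n`-step walks of `SAWCountMonotoneReversal.lean` is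
empty. [cite: BDGS2012, §1.3] -/
theorem doublyTrapped_eq_empty_of_le {n : ℕ} (hn : n + 2 ≤ 4 * d) : doublyTrapped d n = ∅ := by
  refine Finset.eq_empty_of_forall_notMem fun ω hω => ?_
  obtain ⟨hω, h0, -⟩ := mem_doublyTrapped.1 hω
  exact absurd h0 (extCount_pos_of_le hω hn).ne'

/-! ### The case `d = 1` -/

/-- **`BDGS2012_count_mono` in dimension one**: on `ℤ¹`, `c₀ = 1 ≤ c₁` and `cₙ = cₙ₊₁ = 2` for `n ≥ 1`.
[cite: BDGS2012, §1.3] [cite: MadrasSlade1993, §1.1] -/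
theorem count_one_le_count_one_succ (n : ℕ) : count 1 n ≤ count 1 (n + 1) := by
  rcases Nat.eq_zero_or_pos n with rfl | hn
  · rw [count_zero, count_one_eq_two le_rfl]; norm_num
  · rw [count_one_eq_two hn, count_one_eq_two (by omega)]

end Literature.Probability.RandomPlanarGeometry.SAW.Zd
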